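import Mathlib
import Summits.PneNP.PneNP.Theorems.ConvexRankGatesConvexGateBlindAffinePencil

/-!
# PneNP / ConvexRankGates — `ConvexGateBlind`: the `2 × 2` second-order-cone toolkit for valid pencils

Helpers (`--supports stmt-PneNP-10680`), COLUMN-SPACE line (prover seat 2, session 24): the elementary real-algebra half of
`…AffinePencilThree.lean` (one `2 × 2` valid pencil excludes three bare cliques).

* `dotProduct_mulVec_two` — the quadratic form of `[[p, r],[r, s]]`.
* `soc_form_nonneg`, `posSemidef_two_of_sq_le` (registered `posSemidef_two_of_soc`) — `0 ≤ a`, `b₁² + b₂² ≤ a²` ⟹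
  `[[a + b₁, b₂],[b₂, a − b₁]] ⪰ 0` (Cauchy–Schwarz with `(y₀² − y₁²)² + (2y₀y₁)² = (y₀² + y₁²)²`; eigenvalues `a ± |b|`).
* `soc_core_ineq` — the counting inequality behind the three-clique pencil: for `K ≥ 1`, `η = 1/(8K)`, `a₀ = η(K − ½)`,
  integers `0 ≤ n_j ≤ K − 1` and `A ≥ a₀ + (1−η)(n₁ + n₂ + n₃)`: `0 ≤ A` and `(n₁ − n₂)² + n₃² ≤ A²`. [folklore]
-/

set_option linter.dupNamespace false

namespace Summit.PneNP.PneNP.Theorems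

open Finset Real Filter Matrix Literature.Computability.Complexity
open Summit.PneNP.PneNP.Cruxes.ConvexGateBlind.StrictRankConicCover (Edge cdist)

noncomputable section

/-! ## `2 × 2` positive semidefiniteness from the second-order-cone inequality -/

/-- The quadratic form of a symmetric `2 × 2` matrix. [folklore] -/
theorem dotProduct_mulVec_two (p r s : ℝ) (y : Fin 2 → ℝ) :
    y ⬝ᵥ (!![p, r; r, s] *ᵥ y) = p * y 0 ^ 2 + 2 * r * (y 0 * y 1) + s * y 1 ^ 2 := by
  simp [Matrix.mulVec, dotProduct, Fin.sum_univ_two]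
  ring

/-- **The second-order-cone inequality makes the form non-negative.** If `0 ≤ a` and `b₁² + b₂² ≤ a²` then
`a(y₀² + y₁²) + b₁(y₀² − y₁²) + b₂·2y₀y₁ ≥ 0` for all `y` (Cauchy–Schwarz with `(y₀² − y₁²)² + (2y₀y₁)² = (y₀² + y₁²)²`). [folklore] -/
theorem soc_form_nonneg {a b₁ b₂ : ℝ} (ha : 0 ≤ a) (hb : b₁ ^ 2 + b₂ ^ 2 ≤ a ^ 2) (y : Fin 2 → ℝ) :
    0 ≤ a * (y 0 ^ 2 + y 1 ^ 2) + b₁ * (y 0 ^ 2 - y 1 ^ 2) + b₂ * (2 * (y 0 * y 1)) := by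
  set N : ℝ := y 0 ^ 2 + y 1 ^ 2 with hN
  set X : ℝ := y 0 ^ 2 - y 1 ^ 2 with hX
  set Y : ℝ := 2 * (y 0 * y 1) with hY
  have hNXY : X ^ 2 + Y ^ 2 = N ^ 2 := by rw [hN, hX, hY]; ring
  have hN0 : 0 ≤ N := by positivity
  have hcs : (b₁ * X + b₂ * Y) ^ 2 ≤ (a * N) ^ 2 := by
    have h1 : (b₁ * X + b₂ * Y) ^ 2 ≤ (b₁ ^ 2 + b₂ ^ 2) * (X ^ 2 + Y ^ 2) := by
      nlinarith [sq_nonneg (b₁ * Y - b₂ * X)]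
    have h2 : (b₁ ^ 2 + b₂ ^ 2) * (X ^ 2 + Y ^ 2) ≤ a ^ 2 * N ^ 2 := by
      rw [hNXY]; exact mul_le_mul_of_nonneg_right hb (by positivity)
    nlinarith
  have habs := abs_le_of_sq_le_sq' hcs (mul_nonneg ha hN0)
  linarith [habs.1]

/-- **SOC ⟹ PSD for `2 × 2`.** If `0 ≤ a` and `b₁² + b₂² ≤ a²` then `[[a + b₁, b₂],[b₂, a − b₁]] ⪰ 0`
(its eigenvalues are `a ± |b|`). [folklore] -/
theorem posSemidef_two_of_sq_le {a b₁ b₂ : ℝ} (ha : 0 ≤ a) (hb : b₁ ^ 2 + b₂ ^ 2 ≤ a ^ 2) :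
    (!![a + b₁, b₂; b₂, a - b₁] : Matrix (Fin 2) (Fin 2) ℝ).PosSemidef := by
  refine PosSemidef.of_dotProduct_mulVec_nonneg (IsHermitian.ext fun i j => ?_) fun y => ?_
  · fin_cases i <;> fin_cases j <;> simp
  · rw [star_trivial, dotProduct_mulVec_two]
    have h := soc_form_nonneg ha hb y
    linarith

/-! ## The core inequality -/

/-- **Core inequality.** With `K ≥ 1`, `η = 1/(8K)`, `a₀ = η(K − ½)`, integers `0 ≤ n_j ≤ K − 1` and
`A ≥ a₀ + (1 − η)(n₁ + n₂ + n₃)`: `0 ≤ A` and `(n₁ − n₂)² + n₃² ≤ A²`. (One direction present: `a₀ ≥ η n_j`; directions of both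
axes present: `A ≥ n₁ + n₂ + n₃ − 3/8` and `2Pn₃ ≥ P + n₃`; only the first axis: `A ≥ |n₁ − n₂| + η/2`.) [new] -/
theorem soc_core_ineq {K : ℕ} (hK : 1 ≤ K) {n₁ n₂ n₃ : ℕ} (h1 : n₁ + 1 ≤ K) (h2 : n₂ + 1 ≤ K) (h3 : n₃ + 1 ≤ K)
    {A : ℝ} (hA : (1 / (8 * K) : ℝ) * (K - 1 / 2) + (1 - 1 / (8 * K)) * (n₁ + n₂ + n₃) ≤ A) :
    0 ≤ A ∧ ((n₁ : ℝ) - n₂) ^ 2 + (n₃ : ℝ) ^ 2 ≤ A ^ 2 := by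
  have hKr : (1 : ℝ) ≤ K := by exact_mod_cast hK
  set η : ℝ := 1 / (8 * K) with hη
  have hη0 : 0 < η := by rw [hη]; positivity
  have hηK : η * K = 1 / 8 := by rw [hη]; field_simp
  have hη1 : η ≤ 1 / 8 := by
    have : η * 1 ≤ η * K := mul_le_mul_of_nonneg_left hKr hη0.le
    linarith
  have hn1 : (n₁ : ℝ) ≤ K - 1 := by
    have : ((n₁ + 1 : ℕ) : ℝ) ≤ K := by exact_mod_cast h1
    push_cast at this; linarith
  have hn2 : (n₂ : ℝ) ≤ K - 1 := by
    have : ((n₂ + 1 : ℕ) : ℝ) ≤ K := by exact_mod_cast h2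
    push_cast at this; linarith
  have hn3 : (n₃ : ℝ) ≤ K - 1 := by
    have : ((n₃ + 1 : ℕ) : ℝ) ≤ K := by exact_mod_cast h3
    push_cast at this; linarith
  have hn1' : (0 : ℝ) ≤ n₁ := Nat.cast_nonneg _
  have hn2' : (0 : ℝ) ≤ n₂ := Nat.cast_nonneg _
  have hn3' : (0 : ℝ) ≤ n₃ := Nat.cast_nonneg _
  -- `η n_j ≤ η (K − 1) = 1/8 − η`
  have he1 : η * n₁ ≤ 1 / 8 - η := by
    have := mul_le_mul_of_nonneg_left hn1 hη0.le
    linarith [show η * ((K : ℝ) - 1) = η * K - η by ring]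
  have he2 : η * n₂ ≤ 1 / 8 - η := by
    have := mul_le_mul_of_nonneg_left hn2 hη0.le
    linarith [show η * ((K : ℝ) - 1) = η * K - η by ring]
  have he3 : η * n₃ ≤ 1 / 8 - η := by
    have := mul_le_mul_of_nonneg_left hn3 hη0.le
    linarith [show η * ((K : ℝ) - 1) = η * K - η by ring]
  have hen1 : 0 ≤ η * n₁ := mul_nonneg hη0.le hn1'
  have hen2 : 0 ≤ η * n₂ := mul_nonneg hη0.le hn2'
  have hen3 : 0 ≤ η * n₃ := mul_nonneg hη0.le hn3'
  have hη1' : η ≤ 1 := hη1.trans (by norm_num)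
  have hl1 : η * n₁ ≤ n₁ := mul_le_of_le_one_left hn1' hη1'
  have hl2 : η * n₂ ≤ n₂ := mul_le_of_le_one_left hn2' hη1'
  have hl3 : η * n₃ ≤ n₃ := mul_le_of_le_one_left hn3' hη1'
  -- unfold the hypothesis into linear pieces
  have hA' : (η * K - η / 2) + ((n₁ : ℝ) + n₂ + n₃) - (η * n₁ + η * n₂ + η * n₃) ≤ A := by
    have e : η * (K - 1 / 2) + (1 - η) * (n₁ + n₂ + n₃) =
        (η * K - η / 2) + ((n₁ : ℝ) + n₂ + n₃) - (η * n₁ + η * n₂ + η * n₃) := by ring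
    rw [← e]; exact hA
  have hA0 : 0 ≤ A := by linarith
  refine ⟨hA0, ?_⟩
  rcases Nat.eq_zero_or_pos n₃ with h30 | h3p
  · -- only the first axis: `A ≥ |n₁ − n₂|`
    subst h30
    simp only [Nat.cast_zero] at hA' ⊢
    rw [zero_pow two_ne_zero, add_zero]
    have hge1 : (n₁ : ℝ) - n₂ ≤ A := by linarith
    have hge2 : (n₂ : ℝ) - n₁ ≤ A := by linarith
    exact sq_le_sq' (by linarith) hge1
  · have h3r : (1 : ℝ) ≤ n₃ := by exact_mod_cast h3p
    rcases Nat.eq_zero_or_pos (n₁ + n₂) with h120 | h12p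
    · -- only the second axis
      have h10 : n₁ = 0 := by omega
      have h20 : n₂ = 0 := by omega
      subst h10; subst h20
      simp only [Nat.cast_zero, sub_zero] at hA' ⊢
      rw [zero_pow two_ne_zero, zero_add]
      have hge : (n₃ : ℝ) ≤ A := by linarith
      exact sq_le_sq' (by linarith) hge
    · -- both axes: `A ≥ P + n₃ − 3/8`, `2 P n₃ ≥ P + n₃`
      have hPr : (1 : ℝ) ≤ (n₁ : ℝ) + n₂ := by exact_mod_cast h12p
      have hAP : ((n₁ : ℝ) + n₂) + n₃ - 3 / 8 ≤ A := by linarith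
      have hpos : 0 ≤ ((n₁ : ℝ) + n₂) + n₃ - 3 / 8 := by linarith
      have hdiff : ((n₁ : ℝ) - n₂) ^ 2 ≤ ((n₁ : ℝ) + n₂) ^ 2 := by
        have : ((n₁ : ℝ) + n₂) ^ 2 - ((n₁ : ℝ) - n₂) ^ 2 = 4 * (n₁ * n₂) := by ring
        nlinarith [mul_nonneg hn1' hn2']
      have hprod : ((n₁ : ℝ) + n₂) + n₃ ≤ 2 * ((n₁ : ℝ) + n₂) * n₃ := by
        have h := mul_nonneg (show (0 : ℝ) ≤ (n₁ + n₂) - 1 by linarith) (show (0 : ℝ) ≤ n₃ - 1 by linarith)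
        have e : (((n₁ : ℝ) + n₂) - 1) * ((n₃ : ℝ) - 1) = (n₁ + n₂) * n₃ - (n₁ + n₂) - n₃ + 1 := by ring
        rw [e] at h
        nlinarith
      calc ((n₁ : ℝ) - n₂) ^ 2 + (n₃ : ℝ) ^ 2 ≤ ((n₁ : ℝ) + n₂) ^ 2 + (n₃ : ℝ) ^ 2 := by linarith
        _ ≤ (((n₁ : ℝ) + n₂) + n₃ - 3 / 8) ^ 2 := by
            have hexp : (((n₁ : ℝ) + n₂) + n₃ - 3 / 8) ^ 2 = ((n₁ : ℝ) + n₂) ^ 2 + (n₃ : ℝ) ^ 2 +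
                (2 * ((n₁ : ℝ) + n₂) * n₃ - 3 / 4 * ((n₁ + n₂) + n₃) + 9 / 64) := by ring
            rw [hexp]
            linarith
        _ ≤ A ^ 2 := pow_le_pow_left₀ hpos hAP 2

/-- **SOC ⟹ PSD for `2 × 2`** (registered form of `posSemidef_two_of_sq_le`). [folklore] -/
theorem posSemidef_two_of_soc : ∀ (a b₁ b₂ : ℝ), 0 ≤ a → b₁ ^ 2 + b₂ ^ 2 ≤ a ^ 2 → (!![a + b₁, b₂; b₂, a - b₁] : Matrix (Fin 2) (Fin 2) ℝ).PosSemidef :=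
  fun _ _ _ ha hb => posSemidef_two_of_sq_le ha hb

end

end Summit.PneNP.PneNP.Theorems
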